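import Summits.BirchSwinnertonDyer.BirchSwinnertonDyer.Theorems.ManinLocalTwoThreeParabolicCuspFunction
import HarnessLib

/-!
# The Hecke permutation of a parabolic element: the fixed point of weight `r` and the `r`-cycle

Summit `BirchSwinnertonDyer`, route `ManinLocalTwoThree` (cell bsd-f2-manin), cruxes C2 `ManinOddAtFour`
(stmt-BirchSwinnertonDyer-22967) / C3 `ManinPrimeToThreeAtNine` (stmt-BirchSwinnertonDyer-22968).  Fourth file of N4
PARABOLICITY (MEMO-es §22.2 (0), REF1 §R43 N4).  For `Π = g T^w g⁻¹ ∈ Γ₀(L)` (`g ∈ SL₂(ℤ)`, cusp `x = g∞`), a prime `r`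
and the Hecke representatives `βᵢ` (`heckeRep r`), Shimura's permutation data `βᵢ Π = Π'ᵢ β_{σ(i)}` (tree `heckePerm`,
`heckePermElt` at level `L`) are computed from the LEVEL-`1` data of `g` (`βᵢ g = g'ᵢ β_{τ(i)}`):

* at the index `i₀ = τ⁻¹(∞)` (whose `g'_{i₀} = P` is the `ρ_r`-neighbour matrix): `σ(i₀) = i₀` and `Π'_{i₀} = P T^{r w} P⁻¹`
  (`heckePermElt_parabolic_infty`; `β_∞ T^w = T^{rw} β_∞`, tree `diag_mul_T_zpow`);
* at the index `i = τ⁻¹(j)`, `j ∈ ℤ/r`: `σ(i) = τ⁻¹(j + w)` and `Π'ᵢ = g'_{τ⁻¹ j} T^{q} (g'_{τ⁻¹(j+w)})⁻¹` with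
  `q r = j + w − (j + w mod r)` (`heckePermElt_parabolic_some`; `βⱼ T^w = T^q β_{j+w}`),

both identified through the uniqueness of the coset index at level `1` (`existsUnique_heckeRep_mul_coe`).  Hence `σ` has one
fixed point (weight `r`: `u(Π'_{i₀}) = r·u(P T^w P⁻¹)`) and, when `r ∤ w`, one `r`-cycle `j ↦ j + w` whose `Π'` telescope to
`G T^w G⁻¹` (`G = g'_{τ⁻¹ 0}`, the `ρ_r⁻¹`-neighbour matrix) — next file.  No new definitions; nothing about BSD or Manin's
conjecture is proved here.

References: G. Shimura (1971) §8.3 (8.3.2), p. 237; F. Diamond, J. Shurman, GTM 228, §5.2 (5.2); cell memo HOME/MEMO-es.md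
§22.2.
-/

set_option autoImplicit false
set_option linter.dupNamespace false

open scoped MatrixGroups

open CongruenceSubgroup Matrix.SpecialLinearGroup Literature.NumberTheory.EllipticCurves.ModularForms
  Literature.NumberTheory.EllipticCurves.ModularForms.HidaCohomology

namespace Summit.BirchSwinnertonDyer.BirchSwinnertonDyer.Theorems.ManinLocalTwoThree

section PermData

variable {L r : ℕ} (hr : r.Prime)

/-- **Identification of the permutation data through a candidate.**  If `D ∈ SL₂(ℤ)` and an index value `o` satisfy
`D β_o = βᵢ γ` for `γ ∈ Γ₀(L)`, then `σ_γ(i) = o` and `γ'ᵢ = D` — by the uniqueness of the coset index at level `1`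
(`existsUnique_heckeRep_mul_coe`) and cancellation of `β_o`. [cite: Shimura1971, §8.3 p. 237] -/
theorem heckePerm_eq_of_candidate (γ : Gamma0 L) (i : HeckeIdx L r) (o : Option (ZMod r)) (D : SL(2, ℤ))
    (hD : (D : Matrix (Fin 2) (Fin 2) ℤ) * heckeRep r o = heckeRep r i.1 * ((γ : SL(2, ℤ)) : Matrix (Fin 2) (Fin 2) ℤ)) :
    (heckePerm hr γ i).1 = o ∧ ((heckePermElt hr γ i : Gamma0 L) : SL(2, ℤ)) = D := by
  -- both `(σ i, γ'ᵢ)` and `(o, D)` solve the level-`1` coset problem for `βᵢ γ`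
  let γ₁ : Gamma0 1 := ⟨(γ : SL(2, ℤ)), mem_Gamma0_one _⟩
  let i₁ : HeckeIdx 1 r := ⟨i.1, heckeIdx_one_cond hr i.1⟩
  have hu := existsUnique_heckeRep_mul_coe hr γ₁ i₁
  have hspec := heckePermElt_spec hr γ i
  have h1 : ∃ M' ∈ Delta0 1 1, M' * heckeRep r (⟨(heckePerm hr γ i).1, heckeIdx_one_cond hr _⟩ : HeckeIdx 1 r).1
      = heckeRep r i₁.1 * ((γ₁ : SL(2, ℤ)) : Matrix (Fin 2) (Fin 2) ℤ) :=
    ⟨_, coe_mem_delta0_one (⟨((heckePermElt hr γ i : Gamma0 L) : SL(2, ℤ)), mem_Gamma0_one _⟩ : Gamma0 1), hspec⟩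
  have h2 : ∃ M' ∈ Delta0 1 1, M' * heckeRep r (⟨o, heckeIdx_one_cond hr o⟩ : HeckeIdx 1 r).1
      = heckeRep r i₁.1 * ((γ₁ : SL(2, ℤ)) : Matrix (Fin 2) (Fin 2) ℤ) :=
    ⟨_, coe_mem_delta0_one (⟨D, mem_Gamma0_one _⟩ : Gamma0 1), hD⟩
  have heq := hu.unique h1 h2
  have ho : (heckePerm hr γ i).1 = o := congrArg Subtype.val heq
  refine ⟨ho, ?_⟩
  rw [ho] at hspec
  have hmat := matrix_mul_right_cancel_of_det_ne_zero (det_heckeRep_ne_zero hr.ne_zero o) (hspec.trans hD.symm)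
  exact Matrix.SpecialLinearGroup.ext _ _ fun a b ↦ congrFun (congrFun hmat a) b

/-- `β_∞ T^k = T^{r k} β_∞` for `β_∞ = diag(r, 1)` (the tree's `diag_mul_T_zpow`, restated for `heckeRep r none`).
[cite: DiamondShurman2005, §5.2 (5.2)] -/
theorem heckeRep_none_mul_T_zpow (k : ℤ) :
    heckeRep r none * ((ModularGroup.T ^ k : SL(2, ℤ)) : Matrix (Fin 2) (Fin 2) ℤ) =
      ((ModularGroup.T ^ ((r : ℤ) * k) : SL(2, ℤ)) : Matrix (Fin 2) (Fin 2) ℤ) * heckeRep r none := by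
  have h : heckeRep r none = !![(r : ℤ), 0; 0, 1] := rfl
  rw [h]
  exact diag_mul_T_zpow k

/-- `βⱼ T^w = T^q β_{j'}` for `βⱼ = (1 j; 0 r)` whenever `j + w = j' + q r`. [cite: DiamondShurman2005, §5.2 (5.2)] -/
theorem heckeRep_some_mul_T_zpow (j j' : ZMod r) (w q : ℤ) (hq : (j.val : ℤ) + w = (j'.val : ℤ) + q * r) :
    heckeRep r (some j) * ((ModularGroup.T ^ w : SL(2, ℤ)) : Matrix (Fin 2) (Fin 2) ℤ) =
      ((ModularGroup.T ^ q : SL(2, ℤ)) : Matrix (Fin 2) (Fin 2) ℤ) * heckeRep r (some j') := by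
  rw [ModularGroup.coe_T_zpow, ModularGroup.coe_T_zpow]
  ext a b
  fin_cases a <;> fin_cases b <;> simp [heckeRep, Matrix.mul_apply, Fin.sum_univ_two, -ZMod.natCast_val]
  linear_combination hq

/-- From `A β = β' g`: `β g⁻¹ = A⁻¹ β'` (plumbing with `SL₂(ℤ)` inverses as adjugates). [folklore] -/
theorem heckeRep_mul_coe_inv_of_eq {A g : SL(2, ℤ)} {β β' : Matrix (Fin 2) (Fin 2) ℤ}
    (h : (A : Matrix (Fin 2) (Fin 2) ℤ) * β = β' * (g : Matrix (Fin 2) (Fin 2) ℤ)) :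
    β * ((g⁻¹ : SL(2, ℤ)) : Matrix (Fin 2) (Fin 2) ℤ) = ((A⁻¹ : SL(2, ℤ)) : Matrix (Fin 2) (Fin 2) ℤ) * β' := by
  calc β * ((g⁻¹ : SL(2, ℤ)) : Matrix (Fin 2) (Fin 2) ℤ)
      = (((A⁻¹ : SL(2, ℤ)) : Matrix (Fin 2) (Fin 2) ℤ) * (A : Matrix (Fin 2) (Fin 2) ℤ)) * β *
          ((g⁻¹ : SL(2, ℤ)) : Matrix (Fin 2) (Fin 2) ℤ) := by rw [coe_inv_mul_coe, Matrix.one_mul]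
    _ = ((A⁻¹ : SL(2, ℤ)) : Matrix (Fin 2) (Fin 2) ℤ) * (β' * (g : Matrix (Fin 2) (Fin 2) ℤ)) *
          ((g⁻¹ : SL(2, ℤ)) : Matrix (Fin 2) (Fin 2) ℤ) := by rw [Matrix.mul_assoc _ _ β, h]
    _ = ((A⁻¹ : SL(2, ℤ)) : Matrix (Fin 2) (Fin 2) ℤ) * β' := by
          rw [Matrix.mul_assoc, Matrix.mul_assoc, coe_mul_coe_inv, Matrix.mul_one]

/-- **The fixed point of `σ_Π`.**  Let `Π = g T^w g⁻¹ ∈ Γ₀(L)` and let `P ∈ SL₂(ℤ)` satisfy `P β_∞ = β_o g` (the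
level-`1` datum at the index `o = τ⁻¹(∞)`).  Then at the level-`L` index with value `o`: `σ_Π = o` and
`Π' = P T^{r w} P⁻¹`. [cite: Shimura1971, §8.3 (8.3.2)] -/
theorem heckePermElt_parabolic_infty (g : SL(2, ℤ)) (w : ℤ) (hPar : parabolicAt g w ∈ Gamma0 L) (P : SL(2, ℤ))
    (o : Option (ZMod r)) (hP : (P : Matrix (Fin 2) (Fin 2) ℤ) * heckeRep r none = heckeRep r o * (g : Matrix (Fin 2) (Fin 2) ℤ))
    (i : HeckeIdx L r) (hi : i.1 = o) :
    (heckePerm hr ⟨parabolicAt g w, hPar⟩ i).1 = o ∧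
      ((heckePermElt hr ⟨parabolicAt g w, hPar⟩ i : Gamma0 L) : SL(2, ℤ)) = parabolicAt P ((r : ℤ) * w) := by
  apply heckePerm_eq_of_candidate hr
  rw [hi]
  show ((P * ModularGroup.T ^ ((r : ℤ) * w) * P⁻¹ : SL(2, ℤ)) : Matrix (Fin 2) (Fin 2) ℤ) * heckeRep r o =
    heckeRep r o * ((g * ModularGroup.T ^ w * g⁻¹ : SL(2, ℤ)) : Matrix (Fin 2) (Fin 2) ℤ)
  have e1 := heckeRep_mul_coe_inv_of_eq hP
  rw [Matrix.SpecialLinearGroup.coe_mul, Matrix.SpecialLinearGroup.coe_mul, Matrix.SpecialLinearGroup.coe_mul,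
    Matrix.SpecialLinearGroup.coe_mul]
  calc (P : Matrix (Fin 2) (Fin 2) ℤ) * ((ModularGroup.T ^ ((r : ℤ) * w) : SL(2, ℤ)) : Matrix (Fin 2) (Fin 2) ℤ) *
        ((P⁻¹ : SL(2, ℤ)) : Matrix (Fin 2) (Fin 2) ℤ) * heckeRep r o
      = (P : Matrix (Fin 2) (Fin 2) ℤ) * ((ModularGroup.T ^ ((r : ℤ) * w) : SL(2, ℤ)) : Matrix (Fin 2) (Fin 2) ℤ) *
        (((P⁻¹ : SL(2, ℤ)) : Matrix (Fin 2) (Fin 2) ℤ) * heckeRep r o) := by simp only [Matrix.mul_assoc]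
    _ = (P : Matrix (Fin 2) (Fin 2) ℤ) * (((ModularGroup.T ^ ((r : ℤ) * w) : SL(2, ℤ)) : Matrix (Fin 2) (Fin 2) ℤ) *
        heckeRep r none) * ((g⁻¹ : SL(2, ℤ)) : Matrix (Fin 2) (Fin 2) ℤ) := by rw [← e1]; simp only [Matrix.mul_assoc]
    _ = (P : Matrix (Fin 2) (Fin 2) ℤ) * heckeRep r none * ((ModularGroup.T ^ w : SL(2, ℤ)) : Matrix (Fin 2) (Fin 2) ℤ) *
        ((g⁻¹ : SL(2, ℤ)) : Matrix (Fin 2) (Fin 2) ℤ) := by rw [← heckeRep_none_mul_T_zpow]; simp only [Matrix.mul_assoc]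
    _ = heckeRep r o * ((g : Matrix (Fin 2) (Fin 2) ℤ) * ((ModularGroup.T ^ w : SL(2, ℤ)) : Matrix (Fin 2) (Fin 2) ℤ) *
        ((g⁻¹ : SL(2, ℤ)) : Matrix (Fin 2) (Fin 2) ℤ)) := by rw [hP]; simp only [Matrix.mul_assoc]

/-- **The `r`-cycle of `σ_Π`.**  Let `Π = g T^w g⁻¹ ∈ Γ₀(L)`, `j, j' ∈ ℤ/r` and `q ∈ ℤ` with `j + w = j' + q r` (so
`j' = j + w mod r`), and let `G, G' ∈ SL₂(ℤ)` satisfy `G βⱼ = β_o g`, `G' β_{j'} = β_{o'} g` (level-`1` data at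
`o = τ⁻¹(j)`, `o' = τ⁻¹(j')`).  Then at the level-`L` index with value `o`: `σ_Π = o'` and `Π' = G T^q G'⁻¹`.
[cite: Shimura1971, §8.3 (8.3.2)] -/
theorem heckePermElt_parabolic_some (g : SL(2, ℤ)) (w : ℤ) (hPar : parabolicAt g w ∈ Gamma0 L) (G G' : SL(2, ℤ))
    (o o' : Option (ZMod r)) (j j' : ZMod r) (q : ℤ) (hq : (j.val : ℤ) + w = (j'.val : ℤ) + q * r)
    (hG : (G : Matrix (Fin 2) (Fin 2) ℤ) * heckeRep r (some j) = heckeRep r o * (g : Matrix (Fin 2) (Fin 2) ℤ))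
    (hG' : (G' : Matrix (Fin 2) (Fin 2) ℤ) * heckeRep r (some j') = heckeRep r o' * (g : Matrix (Fin 2) (Fin 2) ℤ))
    (i : HeckeIdx L r) (hi : i.1 = o) :
    (heckePerm hr ⟨parabolicAt g w, hPar⟩ i).1 = o' ∧
      ((heckePermElt hr ⟨parabolicAt g w, hPar⟩ i : Gamma0 L) : SL(2, ℤ)) = G * ModularGroup.T ^ q * G'⁻¹ := by
  apply heckePerm_eq_of_candidate hr
  rw [hi]
  show ((G * ModularGroup.T ^ q * G'⁻¹ : SL(2, ℤ)) : Matrix (Fin 2) (Fin 2) ℤ) * heckeRep r o' =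
    heckeRep r o * ((g * ModularGroup.T ^ w * g⁻¹ : SL(2, ℤ)) : Matrix (Fin 2) (Fin 2) ℤ)
  have e1 := heckeRep_mul_coe_inv_of_eq hG'
  rw [Matrix.SpecialLinearGroup.coe_mul, Matrix.SpecialLinearGroup.coe_mul, Matrix.SpecialLinearGroup.coe_mul,
    Matrix.SpecialLinearGroup.coe_mul]
  calc (G : Matrix (Fin 2) (Fin 2) ℤ) * ((ModularGroup.T ^ q : SL(2, ℤ)) : Matrix (Fin 2) (Fin 2) ℤ) *
        ((G'⁻¹ : SL(2, ℤ)) : Matrix (Fin 2) (Fin 2) ℤ) * heckeRep r o'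
      = (G : Matrix (Fin 2) (Fin 2) ℤ) * ((ModularGroup.T ^ q : SL(2, ℤ)) : Matrix (Fin 2) (Fin 2) ℤ) *
        (((G'⁻¹ : SL(2, ℤ)) : Matrix (Fin 2) (Fin 2) ℤ) * heckeRep r o') := by simp only [Matrix.mul_assoc]
    _ = (G : Matrix (Fin 2) (Fin 2) ℤ) * (((ModularGroup.T ^ q : SL(2, ℤ)) : Matrix (Fin 2) (Fin 2) ℤ) *
        heckeRep r (some j')) * ((g⁻¹ : SL(2, ℤ)) : Matrix (Fin 2) (Fin 2) ℤ) := by rw [← e1]; simp only [Matrix.mul_assoc]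
    _ = (G : Matrix (Fin 2) (Fin 2) ℤ) * heckeRep r (some j) * ((ModularGroup.T ^ w : SL(2, ℤ)) : Matrix (Fin 2) (Fin 2) ℤ) *
        ((g⁻¹ : SL(2, ℤ)) : Matrix (Fin 2) (Fin 2) ℤ) := by
          rw [← heckeRep_some_mul_T_zpow j j' w q hq]; simp only [Matrix.mul_assoc]
    _ = heckeRep r o * ((g : Matrix (Fin 2) (Fin 2) ℤ) * ((ModularGroup.T ^ w : SL(2, ℤ)) : Matrix (Fin 2) (Fin 2) ℤ) *
        ((g⁻¹ : SL(2, ℤ)) : Matrix (Fin 2) (Fin 2) ℤ)) := by rw [hG]; simp only [Matrix.mul_assoc]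

end PermData

end Summit.BirchSwinnertonDyer.BirchSwinnertonDyer.Theorems.ManinLocalTwoThree
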